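import Summits.BirchSwinnertonDyer.BirchSwinnertonDyer.Theorems.AlignedTransportAtTwoMainConjectureTransportAlignedAtTwoKilfordCopySameCopy
import Mathlib.LinearAlgebra.BilinearForm.Orthogonal
import HarnessLib

/-!
# Crux C1 `MainConjectureTransportAlignedAtTwo` (stmt-BirchSwinnertonDyer-22296), line `birth`, residual (R2) `stub_lamLawKilford` (Kilford stratum):
# «SAME LETTER ⟹ SAME KERNEL» — H12♯ in the KERNEL currency the (R2) capstone consumes (width seat att-p4 g17; `--supports 22296`;
# sequel of att-p3 g17's `…KilfordCopySymmetricSocle` / `…KilfordCopyMultiplicativeLine` / `…KilfordCopySameCopy`)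

THEOREMS ONLY (no `def`, no `sorry`, no named fact); pure linear algebra over `𝔽₂`, kernel-checked. BSD is not proved by this; C1 is not
closed by this; `F1Sign2.CopyAlignmentAtTwo` / `F1Sign2.MultiplicityTwoOnStratumAtTwo` are not proved by this.

WHY. The (R2) capstone at equal conductors (`…KilfordCopyNegDisc.lamLawKilford_of_conductorNorm_eq_of_ker_iff`, p674335) eats `hker`:
«the two half-class Jacobi maps `θᵢ : J₀(N)[2] → Wᵢ[2]` have the SAME KERNEL». att-p3 g17 kernel-checked -imc's H12♯ in COPY currency
(`range_eq_range_of_eq_of_mem`: two `ρ̄`-equivariant embeddings `ψᵢ : 𝔽₂² ↪ U = J₀(N)[𝔪]` whose canonical vectors land in the multiplicative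
part have the same image), and the route then goes COPY → KERNEL through `twoTorsionCopy`, the intersection pairing and RANK2
(`…KilfordCopyKernel`, `…KilfordCopyRankTwo(Eq)`). This file dualises H12♯ ONCE, abstractly, so that the E-side instantiation
(`…KilfordKernelLetterOnPoints`, this seat) and any future carrier for `J₀(N)[2]` speak directly about the maps `θᵢ` the tree already has
(`…KilfordCopyKernel.exists_theta`) and their kernels:

* §1 the `B`-DUAL `ψ` of a linear `θ : V → 𝔽₂²` (`B (ψ a) v = a ⬝ᵥ θ v`; exists for nondegenerate `B`, `exists_dual`); it is injective when
  `θ` is onto (`dual_injective`), lands in `U` when `θ` kills `U^⊥` (`dual_mem`), intertwines the CONTRAGREDIENT `g ↦ (ρ g⁻¹)ᵀ` when `θ`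
  intertwines `ρ` (`dual_equivariant`), and `ker θ = (range ψ)^⊥` (`apply_eq_zero_iff_forall`);
* §2 **`ker_iff_ker_of_dual_mem`** — H12♯, kernel side: two `ρ̄`-equivariant linear surjections `θ₁ θ₂ : V ↠ 𝔽₂²` killing `U^⊥`, whose
  `B`-duals send a COMMON non-zero `c` into the multiplicative set `M₀` (#`M₀` = 8, socle rows), `#U = 16` ⟹ `∀ v, θ₁ v = 0 ↔ θ₂ v = 0`
  (the contragredient of `ρ̄` again contains the swap and the shear: `(ρ gs)ᵀ`, `(ρ (gs·gt·gs))ᵀ`);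
* §3 **`ker_iff_ker_of_letter`** — the same with the (W0′)-shaped hypothesis a carrier delivers: a submodule `M` (multiplicative part),
  `⊥`-closed inside `U` (`v ∈ U`, `v ⊥ M ⟹ v ∈ M`), `M ∩ U ⊆ M₀`, and BOTH `θᵢ(M)` inside ONE common line `{0, l}` (= «same `2`-adic
  letter», the reading of `AlignedAtTwo` on points); the common canonical dual vector is `c = (l₁, l₀)`.

Dictionary (SYMMETRIC-SOCLE-att-p3-g17.md §2): `V = J₀(N)[2]`, `π` = Galois, `B` = the `w_N`-twisted Weil pairing mod `2` (W3), `U = J₀(N)[𝔪]`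
(`#U = 16` = MULT2), `M` = multiplicative part at `2`, `M₀ = M ∩ U = soc(T̄)·m₀` (W1), `θᵢ` = the parametrisations on `2`-torsion
(`π_{i*}`), (W0′) `θᵢ(M) ⊆ C₂(Wᵢ)[2]` = functoriality of the connected part, «same line» = `AlignedAtTwo` (att-p5 g16
`…PadicLetterOnPoints.letterRespecting_of_alignedAtTwo`).

References (for the reading, not used in the proofs): [Wiese2007Multiplicities, Prop. 2.2, Cor. 4.2]; [KilfordWiese2008, Prop. 2.6, Question 1.9];
[Gross1990, p. 485].
-/

set_option autoImplicit false

noncomputable section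

-- justification: the `Summit.BirchSwinnertonDyer.BirchSwinnertonDyer.…` path repeats a component (route-file convention)
set_option linter.dupNamespace false

open Matrix
open Summit.BirchSwinnertonDyer.BirchSwinnertonDyer.Theorems.AlignedTransportAtTwoKilfordCopySameCopy

namespace Summit.BirchSwinnertonDyer.BirchSwinnertonDyer.Theorems.AlignedTransportAtTwoKilfordKernelLetter

variable {V : Type*} [AddCommGroup V] [Module (ZMod 2) V] {G : Type*} [Group G]

/-! ## §1 The `B`-dual of a linear map `θ : V → 𝔽₂²` -/

/-- A vector of `𝔽₂²` orthogonal to every vector for the dot product is zero. [folklore] -/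
theorem eq_zero_of_forall_dotProduct_eq_zero {w : Fin 2 → ZMod 2} (h : ∀ a : Fin 2 → ZMod 2, a ⬝ᵥ w = 0) : w = 0 := by
  funext i
  have hi := h (Pi.single i 1)
  rwa [single_dotProduct, one_mul] at hi

/-- A vector of `𝔽₂²` whose dot product with every vector vanishes (on the left) is zero. [folklore] -/
theorem eq_zero_of_forall_dotProduct_eq_zero' {a : Fin 2 → ZMod 2} (h : ∀ w : Fin 2 → ZMod 2, a ⬝ᵥ w = 0) : a = 0 := by
  funext i
  have hi := h (Pi.single i 1)
  rwa [dotProduct_single, mul_one] at hi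

/-- **The `B`-dual of `θ`.** For a nondegenerate bilinear form `B` on a finite-dimensional `𝔽₂`-space `V` and a linear
`θ : V → 𝔽₂²` there is a linear `ψ : 𝔽₂² → V` with `B (ψ a) v = a ⬝ᵥ θ v` (`ψ = B♯⁻¹ ∘ θᵀ`). [folklore] -/
theorem exists_dual [FiniteDimensional (ZMod 2) V] (B : LinearMap.BilinForm (ZMod 2) V) (hB : B.Nondegenerate)
    (θ : V →ₗ[ZMod 2] (Fin 2 → ZMod 2)) :
    ∃ ψ : (Fin 2 → ZMod 2) →ₗ[ZMod 2] V, ∀ a v, B (ψ a) v = a ⬝ᵥ θ v := by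
  let L : (Fin 2 → ZMod 2) →ₗ[ZMod 2] Module.Dual (ZMod 2) V :=
    LinearMap.mk₂ (ZMod 2) (fun a v => a ⬝ᵥ θ v)
      (fun a b v => by rw [add_dotProduct])
      (fun r a v => by rw [smul_dotProduct])
      (fun a v w => by rw [map_add, dotProduct_add])
      (fun r a v => by rw [map_smul, dotProduct_smul])
  refine ⟨(B.toDual hB).symm.toLinearMap ∘ₗ L, fun a v => ?_⟩
  rw [LinearMap.comp_apply, LinearEquiv.coe_toLinearMap, LinearMap.BilinForm.apply_toDual_symm_apply]
  rfl

section Dual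

variable (B : LinearMap.BilinForm (ZMod 2) V) (θ : V →ₗ[ZMod 2] (Fin 2 → ZMod 2)) (ψ : (Fin 2 → ZMod 2) →ₗ[ZMod 2] V)

/-- `ker θ = (range ψ)^⊥`: `θ v = 0 ⟺ B (ψ a) v = 0` for all `a`. [folklore] -/
theorem apply_eq_zero_iff_forall (hψ : ∀ a v, B (ψ a) v = a ⬝ᵥ θ v) (v : V) : θ v = 0 ↔ ∀ a, B (ψ a) v = 0 := by
  constructor
  · intro h a
    rw [hψ, h, dotProduct_zero]
  · intro h
    exact eq_zero_of_forall_dotProduct_eq_zero fun a => by rw [← hψ]; exact h a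

/-- The dual of a SURJECTIVE `θ` is injective. [folklore] -/
theorem dual_injective (hψ : ∀ a v, B (ψ a) v = a ⬝ᵥ θ v) (hθ : Function.Surjective θ) : ∀ a, ψ a = 0 → a = 0 := by
  intro a ha
  refine eq_zero_of_forall_dotProduct_eq_zero' fun w => ?_
  obtain ⟨v, rfl⟩ := hθ w
  rw [← hψ, ha, map_zero, LinearMap.zero_apply]

/-- The dual of a `θ` that KILLS `U^⊥` lands in `U` (`B` nondegenerate symmetric, `V` finite-dimensional: `U^⊥⊥ = U`). [folklore] -/
theorem dual_mem [FiniteDimensional (ZMod 2) V] (hB : B.Nondegenerate) (hBsymm : ∀ x y, B x y = B y x)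
    (hψ : ∀ a v, B (ψ a) v = a ⬝ᵥ θ v) (U : Submodule (ZMod 2) V)
    (hθU : ∀ v, (∀ u ∈ U, B u v = 0) → θ v = 0) : ∀ a, ψ a ∈ U := by
  have hrefl : B.IsRefl := fun x y h => by rw [hBsymm]; exact h
  intro a
  rw [← LinearMap.BilinForm.orthogonal_orthogonal hB hrefl U, LinearMap.BilinForm.mem_orthogonal_iff]
  intro n hn
  rw [LinearMap.BilinForm.mem_orthogonal_iff] at hn
  rw [hBsymm, hψ, hθU n hn, dotProduct_zero]

/-- The dual of a `ρ`-EQUIVARIANT `θ` intertwines the CONTRAGREDIENT `g ↦ (ρ g⁻¹)ᵀ` with `π` (`B` nondegenerate and `π`-invariant). [folklore] -/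
theorem dual_equivariant (hB : B.Nondegenerate) (π : Representation (ZMod 2) G V) (ρ : G →* Matrix (Fin 2) (Fin 2) (ZMod 2))
    (hθπ : ∀ g v, θ (π g v) = ρ g *ᵥ θ v) (hBπ : ∀ g x y, B (π g x) (π g y) = B x y)
    (hψ : ∀ a v, B (ψ a) v = a ⬝ᵥ θ v) : ∀ g a, ψ ((ρ g⁻¹)ᵀ *ᵥ a) = π g (ψ a) := by
  intro g a
  have hinv : ∀ v, π g (π g⁻¹ v) = v := fun v => by
    rw [← Module.End.mul_apply, ← map_mul, mul_inv_cancel, map_one, Module.End.one_apply]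
  have key : ∀ v, B (ψ ((ρ g⁻¹)ᵀ *ᵥ a)) v = B (π g (ψ a)) v := fun v => by
    rw [hψ, mulVec_transpose, ← dotProduct_mulVec, ← hθπ]
    conv_rhs => rw [← hinv v, hBπ, hψ]
  refine sub_eq_zero.mp (hB.1 _ fun v => ?_)
  rw [map_sub, LinearMap.sub_apply, key, sub_self]

end Dual

/-! ## §2 H12♯, kernel side -/

/-- The contragredient of the swap is the swap. [folklore] -/
theorem transpose_swap : (!![0, 1; 1, 0] : Matrix (Fin 2) (Fin 2) (ZMod 2))ᵀ = !![0, 1; 1, 0] := by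
  decide

/-- The contragredient of the conjugated shear `s·t·s` is the shear. [folklore] -/
theorem transpose_swap_shear_swap :
    ((!![0, 1; 1, 0] : Matrix (Fin 2) (Fin 2) (ZMod 2)) * !![1, 1; 0, 1] * !![0, 1; 1, 0])ᵀ = !![1, 1; 0, 1] := by
  decide

/-- **H12♯, KERNEL SIDE.** Setting of `…KilfordCopySameCopy.range_eq_range_of_eq_of_mem` (a `π`-stable `U` with `#U = 16`, a nondegenerate
symmetric `π`-invariant `B`, the multiplicative set `M₀` of `8` socle-type images of `m₀`, and `ρ` with the swap and the shear in its range), but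
with two `π/ρ`-EQUIVARIANT linear SURJECTIONS `θ₁ θ₂ : V ↠ 𝔽₂²` killing `U^⊥` in place of the embeddings, and a COMMON non-zero dual vector
`c` whose `B`-duals through `θ₁` and `θ₂` lie in `M₀`: then `θ₁` and `θ₂` have the SAME KERNEL. Proof: the `B`-duals `ψᵢ` of `θᵢ` (§1) are
injective, land in `U`, intertwine the contragredient `g ↦ (ρ g⁻¹)ᵀ` — which takes the values swap at `gs⁻¹` and shear at `(gs·gt·gs)⁻¹` — and
satisfy `ψᵢ c ∈ M₀`; part 3 gives `range ψ₁ = range ψ₂`, and `ker θᵢ = (range ψᵢ)^⊥`. [folklore] -/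
theorem ker_iff_ker_of_dual_mem [FiniteDimensional (ZMod 2) V] (π : Representation (ZMod 2) G V)
    (ρ : G →* Matrix (Fin 2) (Fin 2) (ZMod 2)) {gs gt : G} (hgs : ρ gs = !![0, 1; 1, 0]) (hgt : ρ gt = !![1, 1; 0, 1])
    (U : Submodule (ZMod 2) V) (hπU : ∀ g, ∀ u ∈ U, π g u ∈ U) (hU : Nat.card U = 16)
    (B : LinearMap.BilinForm (ZMod 2) V) (hB : B.Nondegenerate) (hBsymm : ∀ x y, B x y = B y x)
    (hBπ : ∀ g x y, B (π g x) (π g y) = B x y)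
    (M₀ : Set V) (m₀ : V) (hcard : M₀.ncard = 8)
    (hM₀ : ∀ x ∈ M₀, ∃ τ : V →ₗ[ZMod 2] V, (∀ v, τ v ∈ U) ∧ (∀ x y, B (τ x) y = B x (τ y)) ∧
      (∀ g v, τ (π g v) = π g (τ v)) ∧ τ m₀ = x)
    (θ₁ θ₂ : V →ₗ[ZMod 2] (Fin 2 → ZMod 2))
    (hθπ₁ : ∀ g v, θ₁ (π g v) = ρ g *ᵥ θ₁ v) (hθπ₂ : ∀ g v, θ₂ (π g v) = ρ g *ᵥ θ₂ v)
    (hθs₁ : Function.Surjective θ₁) (hθs₂ : Function.Surjective θ₂)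
    (hθU₁ : ∀ v, (∀ u ∈ U, B u v = 0) → θ₁ v = 0) (hθU₂ : ∀ v, (∀ u ∈ U, B u v = 0) → θ₂ v = 0)
    {c : Fin 2 → ZMod 2} (hc : c ≠ 0)
    (hcM₁ : ∃ m ∈ M₀, ∀ v, B m v = c ⬝ᵥ θ₁ v) (hcM₂ : ∃ m ∈ M₀, ∀ v, B m v = c ⬝ᵥ θ₂ v) :
    ∀ v, θ₁ v = 0 ↔ θ₂ v = 0 := by
  classical
  obtain ⟨ψ₁, hψ₁⟩ := exists_dual B hB θ₁
  obtain ⟨ψ₂, hψ₂⟩ := exists_dual B hB θ₂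
  -- the canonical dual vectors `ψᵢ c` lie in `M₀`
  have hmem : ∀ (θ : V →ₗ[ZMod 2] (Fin 2 → ZMod 2)) (ψ : (Fin 2 → ZMod 2) →ₗ[ZMod 2] V),
      (∀ a v, B (ψ a) v = a ⬝ᵥ θ v) → (∃ m ∈ M₀, ∀ v, B m v = c ⬝ᵥ θ v) → ψ c ∈ M₀ := by
    intro θ ψ hψ hcM
    obtain ⟨m, hm, hmv⟩ := hcM
    have h : ψ c = m := by
      refine sub_eq_zero.mp (hB.1 _ fun v => ?_)
      rw [map_sub, LinearMap.sub_apply, hψ, hmv, sub_self]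
    rw [h]; exact hm
  -- the contragredient representation, with the swap and the shear in its range
  let ρd : G →* Matrix (Fin 2) (Fin 2) (ZMod 2) :=
    { toFun := fun g => (ρ g⁻¹)ᵀ
      map_one' := by rw [inv_one, map_one, transpose_one]
      map_mul' := fun g h => by rw [_root_.mul_inv_rev, map_mul, transpose_mul] }
  have hρd : ∀ g, ρd g = (ρ g⁻¹)ᵀ := fun g => rfl
  have hgs' : ρd gs⁻¹ = !![0, 1; 1, 0] := by rw [hρd, inv_inv, hgs, transpose_swap]
  have hgt' : ρd (gs * gt * gs)⁻¹ = !![1, 1; 0, 1] := by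
    rw [hρd, inv_inv, map_mul, map_mul, hgs, hgt, transpose_swap_shear_swap]
  have heq : Set.range ψ₁ = Set.range ψ₂ :=
    range_eq_range_of_eq_of_mem π ρd hgs' hgt' U hπU hU B hB hBsymm hBπ M₀ m₀ hcard hM₀ ψ₁ ψ₂
      (dual_mem B θ₁ ψ₁ hB hBsymm hψ₁ U hθU₁) (dual_mem B θ₂ ψ₂ hB hBsymm hψ₂ U hθU₂)
      (fun g a => by rw [hρd]; exact dual_equivariant B θ₁ ψ₁ hB π ρ hθπ₁ hBπ hψ₁ g a)
      (fun g a => by rw [hρd]; exact dual_equivariant B θ₂ ψ₂ hB π ρ hθπ₂ hBπ hψ₂ g a)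
      (dual_injective B θ₁ ψ₁ hψ₁ hθs₁) (dual_injective B θ₂ ψ₂ hψ₂ hθs₂) hc
      (hmem θ₁ ψ₁ hψ₁ hcM₁) (hmem θ₂ ψ₂ hψ₂ hcM₂)
  -- `ker θᵢ = (range ψᵢ)^⊥`
  intro v
  rw [apply_eq_zero_iff_forall B θ₁ ψ₁ hψ₁, apply_eq_zero_iff_forall B θ₂ ψ₂ hψ₂]
  constructor
  · intro h a
    obtain ⟨b, hb⟩ : ψ₂ a ∈ Set.range ψ₁ := heq ▸ Set.mem_range_self a
    rw [← hb]; exact h b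
  · intro h a
    obtain ⟨b, hb⟩ : ψ₁ a ∈ Set.range ψ₂ := heq.symm ▸ Set.mem_range_self a
    rw [← hb]; exact h b

/-! ## §3 H12♯, kernel side, with the letter hypothesis (W0′) -/

/-- The canonical dual vector of a non-zero `l ∈ 𝔽₂²` is `(l₁, l₀)`: it is non-zero … [folklore] -/
theorem rev_ne_zero {l : Fin 2 → ZMod 2} (hl : l ≠ 0) : ![l 1, l 0] ≠ 0 := by
  revert hl l
  decide

/-- … and orthogonal to `l` (so to the whole line `{0, l}`). [folklore] -/
theorem rev_dotProduct_self (l : Fin 2 → ZMod 2) : ![l 1, l 0] ⬝ᵥ l = 0 := by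
  revert l
  decide

/-- **H12♯, KERNEL SIDE, LETTER FORM — «SAME LETTER ⟹ SAME KERNEL».** As in `ker_iff_ker_of_dual_mem`, but with the hypotheses a carrier for
`J₀(N)[2]` delivers: a submodule `M` (the multiplicative part) that is `⊥`-CLOSED INSIDE `U` (`v ∈ U` orthogonal to `M` lies in `M` — maximal
isotropy on the `𝔪`-component), `M ∩ U ⊆ M₀` (the socle set), and (W0′) both `θ₁(M)` and `θ₂(M)` contained in ONE common line `{0, l}`, `l ≠ 0`
(«same `2`-adic letter»: `θᵢ(M) ⊆ C₂(Wᵢ)[2]` by functoriality of the connected part, and `AlignedAtTwo` matches the letters). Then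
`∀ v, θ₁ v = 0 ↔ θ₂ v = 0`. Proof: the `B`-dual of `c = (l₁, l₀)` through `θᵢ` lies in `U` (§1) and is orthogonal to `M` (`c ⬝ᵥ θᵢ m ∈ {c⬝0, c⬝l} = 0`),
hence in `M ∩ U ⊆ M₀`; apply §2. [folklore] -/
theorem ker_iff_ker_of_letter [FiniteDimensional (ZMod 2) V] (π : Representation (ZMod 2) G V)
    (ρ : G →* Matrix (Fin 2) (Fin 2) (ZMod 2)) {gs gt : G} (hgs : ρ gs = !![0, 1; 1, 0]) (hgt : ρ gt = !![1, 1; 0, 1])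
    (U : Submodule (ZMod 2) V) (hπU : ∀ g, ∀ u ∈ U, π g u ∈ U) (hU : Nat.card U = 16)
    (B : LinearMap.BilinForm (ZMod 2) V) (hB : B.Nondegenerate) (hBsymm : ∀ x y, B x y = B y x)
    (hBπ : ∀ g x y, B (π g x) (π g y) = B x y)
    (M : Submodule (ZMod 2) V) (hMU : ∀ v ∈ U, (∀ m ∈ M, B m v = 0) → v ∈ M)
    (M₀ : Set V) (m₀ : V) (hcard : M₀.ncard = 8) (hMM₀ : ∀ x ∈ M, x ∈ U → x ∈ M₀)
    (hM₀ : ∀ x ∈ M₀, ∃ τ : V →ₗ[ZMod 2] V, (∀ v, τ v ∈ U) ∧ (∀ x y, B (τ x) y = B x (τ y)) ∧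
      (∀ g v, τ (π g v) = π g (τ v)) ∧ τ m₀ = x)
    (θ₁ θ₂ : V →ₗ[ZMod 2] (Fin 2 → ZMod 2))
    (hθπ₁ : ∀ g v, θ₁ (π g v) = ρ g *ᵥ θ₁ v) (hθπ₂ : ∀ g v, θ₂ (π g v) = ρ g *ᵥ θ₂ v)
    (hθs₁ : Function.Surjective θ₁) (hθs₂ : Function.Surjective θ₂)
    (hθU₁ : ∀ v, (∀ u ∈ U, B u v = 0) → θ₁ v = 0) (hθU₂ : ∀ v, (∀ u ∈ U, B u v = 0) → θ₂ v = 0)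
    {l : Fin 2 → ZMod 2} (hl : l ≠ 0)
    (hθM₁ : ∀ m ∈ M, θ₁ m = 0 ∨ θ₁ m = l) (hθM₂ : ∀ m ∈ M, θ₂ m = 0 ∨ θ₂ m = l) :
    ∀ v, θ₁ v = 0 ↔ θ₂ v = 0 := by
  classical
  -- the `B`-dual of `c = (l₁, l₀)` through `θᵢ` lies in `M ∩ U ⊆ M₀`
  have hdual : ∀ (θ : V →ₗ[ZMod 2] (Fin 2 → ZMod 2)), (∀ v, (∀ u ∈ U, B u v = 0) → θ v = 0) →
      (∀ m ∈ M, θ m = 0 ∨ θ m = l) → ∃ m ∈ M₀, ∀ v, B m v = ![l 1, l 0] ⬝ᵥ θ v := by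
    intro θ hθU hθM
    obtain ⟨ψ, hψ⟩ := exists_dual B hB θ
    have hU' : ψ ![l 1, l 0] ∈ U := dual_mem B θ ψ hB hBsymm hψ U hθU _
    have hM' : ψ ![l 1, l 0] ∈ M := by
      refine hMU _ hU' fun m hm => ?_
      rw [hBsymm, hψ]
      rcases hθM m hm with h | h
      · rw [h, dotProduct_zero]
      · rw [h, rev_dotProduct_self]
    exact ⟨ψ ![l 1, l 0], hMM₀ _ hM' hU', hψ _⟩
  exact ker_iff_ker_of_dual_mem π ρ hgs hgt U hπU hU B hB hBsymm hBπ M₀ m₀ hcard hM₀ θ₁ θ₂ hθπ₁ hθπ₂ hθs₁ hθs₂ hθU₁ hθU₂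
    (rev_ne_zero hl) (hdual θ₁ hθU₁ hθM₁) (hdual θ₂ hθU₂ hθM₂)

end Summit.BirchSwinnertonDyer.BirchSwinnertonDyer.Theorems.AlignedTransportAtTwoKilfordKernelLetter

end
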